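import Literature.NumberTheory.ConnesConsani2021.SeriesRemainderBounds
import Mathlib.Analysis.Calculus.ParametricIntervalIntegral
import Mathlib.Analysis.SpecialFunctions.Trigonometric.Deriv
import HarnessLib

/-!
# Connes–Consani 2021, §4–§5 / App. E: calculus of the cosine transform
# `η̃(y) = ∫_{-1}^{1} ψ(x) cos(2πxy) dx` of a cut-off function — derivatives under the integral sign

RH-FREE corpus literature (label, line 1): elementary differentiation under the integral sign for
the Fourier (cosine) transform of a function supported in `[−1, 1]`; nothing in this file mentions
`ζ`, the critical strip or RH, and nothing here bears on the truth of RH.  bears_on (cell rh-crit,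
corpus C1): apex input (B) «density of `E`» — the regularity `η̃ ∈ C²(ℝ)` of
`cosTransform ψ` (`SeriesRemainderBounds.lean`) is the hypothesis on `η` of the Lemma 5.2 file
(`ScalingCoeffBoundaryTerms.lean`, `exists_contDiff_truncScalingCoeff`) and the derivative
formulas are the ones Appendix E differentiates ("`∂_yζ_n` is the Fourier transform of
`2πixζ_n(x)`", p0035:L16; "`η_n′(ρ) = −4π∫_0^1 sin(2πρx)ξ_n(x)x dx`", p0035:L55).

Source: A. Connes, C. Consani, *Weil positivity and trace formula, the archimedean place*, Selecta
Math. (N.S.) 27 (2021) 77 = arXiv:2006.13771 [bib `ConnesConsani2021`], Prop. 4.5 (i) (arXiv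
Prop. 25: `η_n = 𝔽_{e_ℝ}ξ_n`, p0016:L50) and App. E (p0035:L16, L55).  In the tree normalisation
of `SeriesRemainderBounds.lean` (`ψ = ξ_n/√2` even, real, supported in `[−1,1]`;
`cosTransform ψ y = ∫_{-1}^1 ψ(x)cos(2πxy)dx = η_n(y)/√2`), for any `ψ` interval-integrable on
`[−1, 1]` (no parity or smoothness of `ψ` is needed for differentiating in `y`):

* (the first derivative `η̃′(y) = −∫_{-1}^1 2πx ψ(x) sin(2πxy) dx`, App. E p0035:L55, is the tree's
  `hasDerivAt_cosTransform` in `SeriesRemainderBounds.lean` for `ψ` continuous on `[−1,1]`; here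
  `deriv_cosTransform` records it for interval-integrable `ψ`);
* `hasDerivAt_deriv_cosTransform` — `η̃″(y) = −∫_{-1}^1 (2πx)² ψ(x) cos(2πxy) dx`;
* `contDiff_two_cosTransform` — `η̃ ∈ C²(ℝ)`;
* `abs_cosTransform_le_integral`, `abs_deriv_cosTransform_le_integral`,
  `abs_deriv_deriv_cosTransform_le`
  — the pointwise bounds `|η̃| ≤ ∫|ψ|`, `|η̃′| ≤ 2π∫|ψ|`, `|η̃″| ≤ 4π²∫|ψ|` on `[−1,1]` (`|x| ≤ 1`).

All proved (Mathlib's `intervalIntegral.hasDerivAt_integral_of_dominated_loc_of_deriv_le` with the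
dominating function `(2π)ᵏ|ψ|`); no named fact is introduced.
-/

noncomputable section

open Real MeasureTheory Set Filter intervalIntegral Metric
open scoped Topology

namespace Literature.NumberTheory.ConnesConsani2021

variable {ψ : ℝ → ℝ}

/-- On `Ι (-1) 1` one has `|x| ≤ 1`. [folklore] -/
private theorem abs_le_one_of_mem_uIoc {x : ℝ} (hx : x ∈ Set.uIoc (-1 : ℝ) 1) : |x| ≤ 1 := by
  rw [uIoc_of_le (by norm_num : (-1 : ℝ) ≤ 1)] at hx
  exact abs_le.2 ⟨hx.1.le, hx.2⟩

/-- Measurability of `ψ` on `Ι (-1) 1` from interval integrability. [folklore] -/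
private theorem aesm_of_intervalIntegrable (hψ : IntervalIntegrable ψ volume (-1) 1) :
    AEStronglyMeasurable ψ (volume.restrict (Set.uIoc (-1 : ℝ) 1)) :=
  (intervalIntegrable_iff.1 hψ).aestronglyMeasurable

/-- `η̃′(y) = −∫_{-1}^1 2πx ψ(x) sin(2πxy) dx` for `ψ` merely interval-integrable on `[−1,1]`
(the tree's `hasDerivAt_cosTransform` of `SeriesRemainderBounds.lean` assumes `ψ` continuous on
`[−1,1]`; same dominated-convergence proof). [folklore] -/
private theorem hasDerivAt_cosTransform_of_intervalIntegrable
    (hψ : IntervalIntegrable ψ volume (-1) 1) (y : ℝ) :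
    HasDerivAt (cosTransform ψ)
      (∫ x in (-1 : ℝ)..1, ψ x * (-(2 * π * x) * Real.sin (2 * π * x * y))) y := by
  have hmeas := aesm_of_intervalIntegrable hψ
  have h := intervalIntegral.hasDerivAt_integral_of_dominated_loc_of_deriv_le
    (F := fun y x ↦ ψ x * Real.cos (2 * π * x * y))
    (F' := fun y x ↦ ψ x * (-(2 * π * x) * Real.sin (2 * π * x * y)))
    (x₀ := y) (a := -1) (b := 1) (bound := fun x ↦ 2 * π * |ψ x|) (μ := volume) univ_mem
    ?_ ?_ ?_ ?_ ?_ ?_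
  · exact h.2
  · exact Eventually.of_forall fun z ↦
      hmeas.mul (by fun_prop : Continuous fun x ↦ Real.cos (2 * π * x * z)).aestronglyMeasurable
  · exact hψ.mul_continuousOn
      (by fun_prop : Continuous fun x ↦ Real.cos (2 * π * x * y)).continuousOn
  · exact hmeas.mul
      (by fun_prop :
        Continuous fun x ↦ -(2 * π * x) * Real.sin (2 * π * x * y)).aestronglyMeasurable
  · refine Eventually.of_forall fun x hx z _ ↦ ?_
    have hx1 := abs_le_one_of_mem_uIoc hx
    rw [Real.norm_eq_abs, abs_mul, abs_mul, abs_neg]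
    have hs := Real.abs_sin_le_one (2 * π * x * z)
    have h2 : |2 * π * x| ≤ 2 * π := by
      rw [abs_mul, abs_of_pos (by positivity : (0 : ℝ) < 2 * π)]
      nlinarith [Real.pi_pos]
    calc |ψ x| * (|2 * π * x| * |Real.sin (2 * π * x * z)|)
        ≤ |ψ x| * (2 * π * 1) :=
          mul_le_mul_of_nonneg_left (mul_le_mul h2 hs (abs_nonneg _) (by positivity))
            (abs_nonneg _)
      _ = 2 * π * |ψ x| := by ring
  · exact (hψ.abs.const_mul (2 * π))
  · refine Eventually.of_forall fun x _ z _ ↦ ?_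
    have h1 := (((hasDerivAt_id' z).const_mul (2 * π * x)).cos).const_mul (ψ x)
    exact h1.congr_deriv (by ring)

/-- **`η̃″(y) = −∫_{-1}^1 (2πx)² ψ(x) cos(2πxy) dx`** — the second derivative under the integral
sign. [cite: ConnesConsani2021, App. E p. 35 (p0035:L16, L55)] -/
theorem hasDerivAt_deriv_cosTransform (hψ : IntervalIntegrable ψ volume (-1) 1) (y : ℝ) :
    HasDerivAt (fun y ↦ ∫ x in (-1 : ℝ)..1, ψ x * (-(2 * π * x) * Real.sin (2 * π * x * y)))
      (∫ x in (-1 : ℝ)..1, ψ x * (-(2 * π * x) ^ 2 * Real.cos (2 * π * x * y))) y := by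
  have hmeas := aesm_of_intervalIntegrable hψ
  have h := intervalIntegral.hasDerivAt_integral_of_dominated_loc_of_deriv_le
    (F := fun y x ↦ ψ x * (-(2 * π * x) * Real.sin (2 * π * x * y)))
    (F' := fun y x ↦ ψ x * (-(2 * π * x) ^ 2 * Real.cos (2 * π * x * y)))
    (x₀ := y) (a := -1) (b := 1) (bound := fun x ↦ (2 * π) ^ 2 * |ψ x|) (μ := volume) univ_mem
    ?_ ?_ ?_ ?_ ?_ ?_
  · exact h.2
  · exact Eventually.of_forall fun z ↦ hmeas.mul
      (by fun_prop :
        Continuous fun x ↦ -(2 * π * x) * Real.sin (2 * π * x * z)).aestronglyMeasurable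
  · exact hψ.mul_continuousOn
      (by fun_prop : Continuous fun x ↦ -(2 * π * x) * Real.sin (2 * π * x * y)).continuousOn
  · exact hmeas.mul
      (by fun_prop :
        Continuous fun x ↦ -(2 * π * x) ^ 2 * Real.cos (2 * π * x * y)).aestronglyMeasurable
  · refine Eventually.of_forall fun x hx z _ ↦ ?_
    have hx1 := abs_le_one_of_mem_uIoc hx
    rw [Real.norm_eq_abs, abs_mul, abs_mul, abs_neg]
    have hc := Real.abs_cos_le_one (2 * π * x * z)
    have h2 : |(2 * π * x) ^ 2| ≤ (2 * π) ^ 2 := by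
      rw [abs_pow, abs_mul, abs_of_pos (by positivity : (0 : ℝ) < 2 * π)]
      have h3 : 2 * π * |x| ≤ 2 * π * 1 := by nlinarith [Real.pi_pos]
      have h4 : (2 * π * |x|) ^ 2 ≤ (2 * π * 1) ^ 2 := pow_le_pow_left₀ (by positivity) h3 2
      simpa using h4
    calc |ψ x| * (|(2 * π * x) ^ 2| * |Real.cos (2 * π * x * z)|)
        ≤ |ψ x| * ((2 * π) ^ 2 * 1) :=
          mul_le_mul_of_nonneg_left (mul_le_mul h2 hc (abs_nonneg _) (by positivity))
            (abs_nonneg _)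
      _ = (2 * π) ^ 2 * |ψ x| := by ring
  · exact (hψ.abs.const_mul ((2 * π) ^ 2))
  · refine Eventually.of_forall fun x _ z _ ↦ ?_
    have h1 := ((((hasDerivAt_id' z).const_mul (2 * π * x)).sin).const_mul (-(2 * π * x))).const_mul
      (ψ x)
    exact h1.congr_deriv (by ring)

/-- The function-level first derivative of `cosTransform ψ`.
[cite: ConnesConsani2021, App. E p. 35 (p0035:L55)] -/
theorem deriv_cosTransform (hψ : IntervalIntegrable ψ volume (-1) 1) :
    deriv (cosTransform ψ) =
      fun y ↦ ∫ x in (-1 : ℝ)..1, ψ x * (-(2 * π * x) * Real.sin (2 * π * x * y)) :=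
  funext fun y ↦ (hasDerivAt_cosTransform_of_intervalIntegrable hψ y).deriv

/-- The function-level second derivative of `cosTransform ψ`.
[cite: ConnesConsani2021, App. E p. 35 (p0035:L16, L55)] -/
theorem deriv_deriv_cosTransform (hψ : IntervalIntegrable ψ volume (-1) 1) :
    deriv (deriv (cosTransform ψ)) =
      fun y ↦ ∫ x in (-1 : ℝ)..1, ψ x * (-(2 * π * x) ^ 2 * Real.cos (2 * π * x * y)) := by
  rw [deriv_cosTransform hψ]
  exact funext fun y ↦ (hasDerivAt_deriv_cosTransform hψ y).deriv

/-- The second derivative of `cosTransform ψ` is continuous (dominated continuity).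
[cite: ConnesConsani2021, App. E p. 35 (p0035:L16)] -/
theorem continuous_deriv_deriv_cosTransform (hψ : IntervalIntegrable ψ volume (-1) 1) :
    Continuous (deriv (deriv (cosTransform ψ))) := by
  rw [deriv_deriv_cosTransform hψ]
  have hmeas := aesm_of_intervalIntegrable hψ
  refine intervalIntegral.continuous_of_dominated_interval
    (F := fun y x ↦ ψ x * (-(2 * π * x) ^ 2 * Real.cos (2 * π * x * y)))
    (bound := fun x ↦ (2 * π) ^ 2 * |ψ x|) (a := -1) (b := 1) (μ := volume) ?_ ?_ ?_ ?_
  · exact fun z ↦ hmeas.mul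
      (by fun_prop :
        Continuous fun x ↦ -(2 * π * x) ^ 2 * Real.cos (2 * π * x * z)).aestronglyMeasurable
  · refine fun z ↦ Eventually.of_forall fun x hx ↦ ?_
    have hx1 := abs_le_one_of_mem_uIoc hx
    rw [Real.norm_eq_abs, abs_mul, abs_mul, abs_neg]
    have hc := Real.abs_cos_le_one (2 * π * x * z)
    have h2 : |(2 * π * x) ^ 2| ≤ (2 * π) ^ 2 := by
      rw [abs_pow, abs_mul, abs_of_pos (by positivity : (0 : ℝ) < 2 * π)]
      have h3 : 2 * π * |x| ≤ 2 * π * 1 := by nlinarith [Real.pi_pos]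
      have h4 : (2 * π * |x|) ^ 2 ≤ (2 * π * 1) ^ 2 := pow_le_pow_left₀ (by positivity) h3 2
      simpa using h4
    calc |ψ x| * (|(2 * π * x) ^ 2| * |Real.cos (2 * π * x * z)|)
        ≤ |ψ x| * ((2 * π) ^ 2 * 1) :=
          mul_le_mul_of_nonneg_left (mul_le_mul h2 hc (abs_nonneg _) (by positivity))
            (abs_nonneg _)
      _ = (2 * π) ^ 2 * |ψ x| := by ring
  · exact (hψ.abs.const_mul ((2 * π) ^ 2))
  · exact Eventually.of_forall fun x _ ↦
      (by fun_prop : Continuous fun z ↦ ψ x * (-(2 * π * x) ^ 2 * Real.cos (2 * π * x * z)))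

/-- **`η̃ = cosTransform ψ ∈ C²(ℝ)`** for `ψ` interval-integrable on `[−1,1]` (the hypothesis
`ContDiff ℝ 2 η` of `exists_contDiff_truncScalingCoeff` for the §5 data `η = cosTransform ψ`).
[cite: ConnesConsani2021, Prop. 4.5 (i) §4 p. 16 (arXiv Prop. 25); App. E p. 35 (p0035:L16)] -/
theorem contDiff_two_cosTransform (hψ : IntervalIntegrable ψ volume (-1) 1) :
    ContDiff ℝ 2 (cosTransform ψ) := by
  have hd1 : Differentiable ℝ (cosTransform ψ) := fun y ↦
    (hasDerivAt_cosTransform_of_intervalIntegrable hψ y).differentiableAt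
  have hd2 : Differentiable ℝ (deriv (cosTransform ψ)) := by
    rw [deriv_cosTransform hψ]
    exact fun y ↦ (hasDerivAt_deriv_cosTransform hψ y).differentiableAt
  rw [show (2 : WithTop ℕ∞) = 1 + 1 by norm_num, contDiff_succ_iff_deriv]
  refine ⟨hd1, fun h ↦ absurd h (by simp), ?_⟩
  rw [show (1 : WithTop ℕ∞) = 0 + 1 by norm_num, contDiff_succ_iff_deriv]
  refine ⟨hd2, fun h ↦ absurd h (by simp), ?_⟩
  rw [contDiff_zero]
  exact continuous_deriv_deriv_cosTransform hψ

/-! ## Pointwise bounds (`|x| ≤ 1` on the range of integration) -/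

/-- `|η̃(y)| ≤ ∫_{-1}^1 |ψ|` (interval-integrable `ψ`; the tree's `abs_cosTransform_le` is the
unit-normalised continuous case, constant `99/70`).
[cite: ConnesConsani2021, App. E p. 35 (p0035:L16)] -/
theorem abs_cosTransform_le_integral (hψ : IntervalIntegrable ψ volume (-1) 1) (y : ℝ) :
    |cosTransform ψ y| ≤ ∫ x in (-1 : ℝ)..1, |ψ x| := by
  rw [cosTransform]
  refine intervalIntegral.abs_integral_le_integral_abs (by norm_num) |>.trans ?_
  refine intervalIntegral.integral_mono_on (by norm_num) ?_ hψ.abs fun x _ ↦ ?_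
  · exact (hψ.mul_continuousOn
      (by fun_prop : Continuous fun x ↦ Real.cos (2 * π * x * y)).continuousOn).abs
  · rw [abs_mul]
    exact mul_le_of_le_one_right (abs_nonneg _) (Real.abs_cos_le_one _)

/-- `|η̃′(y)| ≤ 2π ∫_{-1}^1 |ψ|` (for merely interval-integrable `ψ`; the tree's
`abs_deriv_cosTransform_le` is the unit-normalised continuous case with the constant `99π/35`).
[cite: ConnesConsani2021, App. E p. 35 (p0035:L55)] -/
theorem abs_deriv_cosTransform_le_integral (hψ : IntervalIntegrable ψ volume (-1) 1) (y : ℝ) :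
    |deriv (cosTransform ψ) y| ≤ 2 * π * ∫ x in (-1 : ℝ)..1, |ψ x| := by
  rw [deriv_cosTransform hψ]
  dsimp only
  rw [← intervalIntegral.integral_const_mul]
  refine intervalIntegral.abs_integral_le_integral_abs (by norm_num) |>.trans ?_
  refine intervalIntegral.integral_mono_on (by norm_num) ?_ (hψ.abs.const_mul _) fun x hx ↦ ?_
  · exact (hψ.mul_continuousOn
      (by fun_prop : Continuous fun x ↦ -(2 * π * x) * Real.sin (2 * π * x * y)).continuousOn).abs
  · have hx1 : |x| ≤ 1 := abs_le.2 ⟨hx.1, hx.2⟩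
    rw [abs_mul, abs_mul, abs_neg, abs_mul, abs_of_pos (by positivity : (0 : ℝ) < 2 * π)]
    have hs := Real.abs_sin_le_one (2 * π * x * y)
    have h0 : 0 ≤ |ψ x| := abs_nonneg _
    have h4 : 2 * π * |x| * |Real.sin (2 * π * x * y)| ≤ 2 * π * 1 * 1 :=
      mul_le_mul (mul_le_mul_of_nonneg_left hx1 (by positivity)) hs (abs_nonneg _) (by positivity)
    calc |ψ x| * (2 * π * |x| * |Real.sin (2 * π * x * y)|)
        ≤ |ψ x| * (2 * π * 1 * 1) := mul_le_mul_of_nonneg_left h4 h0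
      _ = 2 * π * |ψ x| := by ring

/-- `|η̃″(y)| ≤ 4π² ∫_{-1}^1 |ψ|`. [cite: ConnesConsani2021, App. E p. 35 (p0035:L16)] -/
theorem abs_deriv_deriv_cosTransform_le (hψ : IntervalIntegrable ψ volume (-1) 1) (y : ℝ) :
    |deriv (deriv (cosTransform ψ)) y| ≤ (2 * π) ^ 2 * ∫ x in (-1 : ℝ)..1, |ψ x| := by
  rw [deriv_deriv_cosTransform hψ]
  dsimp only
  rw [← intervalIntegral.integral_const_mul]
  refine intervalIntegral.abs_integral_le_integral_abs (by norm_num) |>.trans ?_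
  refine intervalIntegral.integral_mono_on (by norm_num) ?_ (hψ.abs.const_mul _) fun x hx ↦ ?_
  · exact (hψ.mul_continuousOn
      (by fun_prop :
        Continuous fun x ↦ -(2 * π * x) ^ 2 * Real.cos (2 * π * x * y)).continuousOn).abs
  · have hx1 : |x| ≤ 1 := abs_le.2 ⟨hx.1, hx.2⟩
    rw [abs_mul, abs_mul, abs_neg, abs_pow, abs_mul, abs_of_pos (by positivity : (0 : ℝ) < 2 * π)]
    have hc := Real.abs_cos_le_one (2 * π * x * y)
    have h0 : 0 ≤ |ψ x| := abs_nonneg _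
    have hx2 : |x| ^ 2 ≤ 1 := by nlinarith [abs_nonneg x]
    have h4 : (2 * π * |x|) ^ 2 * |Real.cos (2 * π * x * y)| ≤ (2 * π) ^ 2 := by
      have hp : 0 < (2 * π) ^ 2 := by positivity
      calc (2 * π * |x|) ^ 2 * |Real.cos (2 * π * x * y)|
          ≤ (2 * π * |x|) ^ 2 * 1 := mul_le_mul_of_nonneg_left hc (by positivity)
        _ = (2 * π) ^ 2 * |x| ^ 2 := by ring
        _ ≤ (2 * π) ^ 2 * 1 := mul_le_mul_of_nonneg_left hx2 hp.le
        _ = (2 * π) ^ 2 := by ring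
    calc |ψ x| * ((2 * π * |x|) ^ 2 * |Real.cos (2 * π * x * y)|)
        ≤ |ψ x| * (2 * π) ^ 2 := mul_le_mul_of_nonneg_left h4 h0
      _ = (2 * π) ^ 2 * |ψ x| := by ring

/-- **The §5 datum**: for a cut-off prolate function `ψ` (`IsProlateFunction 1 m ψ`: `C²` on
`[−1,1]`), `η̃ = cosTransform ψ ∈ C²(ℝ)` — the hypothesis on `η` of
`exists_contDiff_truncScalingCoeff` (Lemma 5.2) for the terms of the series (sonine0)/(sonineQ).
[cite: ConnesConsani2021, Prop. 4.5 (i) §4 p. 16 (arXiv Prop. 25); Prop. 5.3 §5 p. 20] -/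
theorem contDiff_two_cosTransform_of_isProlateFunction {m : ℕ}
    (hψ : Literature.NumberTheory.LFunctions.IsProlateFunction 1 m ψ) :
    ContDiff ℝ 2 (cosTransform ψ) := by
  refine contDiff_two_cosTransform (ContinuousOn.intervalIntegrable ?_)
  rw [uIcc_of_le (by norm_num : (-1 : ℝ) ≤ 1)]
  exact hψ.contDiffOn.continuousOn

end Literature.NumberTheory.ConnesConsani2021

end
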